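import Summits.QuantumFields.QCD.Theorems.QuarksNoInfraredClauseThinQCDStubDiagonalExtraction
import HarnessLib

/-!
# Stub `stub_diagonalExtractionT` (DE″) of line `registered` (skeleton r6) — crux `ThinQCD` (item stmt-QuantumFields-17278)

Route `QuarksNoInfraredClause`, crux decl `Summit.QuantumFields.QCD.Theses.QuarksNoInfraredClause.ThinQCD`; helper file,
`--supports stmt-QuantumFields-17278`.  PURE ANALYSIS (no physics), the CURRENCY-HONEST form of the landed diagonal
extraction `stub_diagonalExtraction` (p167000): for ANY calibrated species family `𝒞` over ANY regularisation,

* PER-TUPLE ⁰𝒮-tightness of the canonical lattice distributions `qcdLatticeDist (𝒞.scheme m) k n σ` at every positive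
  tuple `m` (exactly the `T`-half of the per-tuple deliverable `(T ∧ COMP)` of the certified re-type 18044′ /
  `ConvergentOSClosure` R′ — one Schwartz index `s`, eventually in `k`), and
* the mass-Lipschitz modulus in TENSOR currency (VERBATIM the body of `MassLipschitz` of the registered stub
  `stub_calibratedControl` of crux `ChiralCalibratedConvergence`, stmt-QuantumFields-18044, i.e. of
  `DiagonalSpine.MassEquicontinuity`: compactly supported off-diagonal REAL TENSOR tuples, `n ≠ 0`, per-tuple constants)

give ONE strictly increasing `ψ` along which `k ↦ qcdLatticeDist (𝒞.scheme m) (ψ k) n σ F` converges for every positive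
tuple `m`, every `n`, `σ` and EVERY `F ∈ ⁰𝒮((ℝ⁴)ⁿ)`.  Compared with p167000 the locally-uniform-in-`m` tightness is
dropped altogether and the Lipschitz modulus is asked only where an upstream UV theorem states it (smeared-field
correlators of compactly supported real test functions), so the lattice package of the line is implied VERBATIM by the
registered stubs of 18044 plus the per-tuple deliverables.

Proof.  (1) `exists_countable_total_real` — the countable total family of off-diagonal real tensors of
`exists_countable_total` (p166156) with its factor data exposed: each generator is `⊗ᵢ ofRealTest (fᵢ)` for real,
COMPACTLY SUPPORTED `fᵢ` (real/imaginary parts of the box characters `charFactorS`, supported in the compact blocks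
`blockK`).  (2) The eventual-Lipschitz Arzelà–Ascoli lemma `exists_strictMono_forall_pos_tendsto` (p155449) over the
countable labels `(n, σ, generator)`: pointwise eventual bounds come from the per-tuple tightness, the modulus on compacts
from the tensor-currency Lipschitz hypothesis read through `qcdLatticeSchwinger_eq_qcdLatticeDist` (degree `0` is the
constant functional `evalAt`).  (3) The ε/3 lemma `tendsto_offDiagonal_of_generators` (p167000) at each positive tuple.

Refs: Reed–Simon I, Thm I.2 / §V.3 (ε/3); Osterwalder–Schrader, CMP 31 (1973) §2 (`⁰𝒮`); Arzelà–Ascoli (folklore).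
No definition, no named fact, no `sorry`.
-/

noncomputable section

open scoped SchwartzMap Topology
open Filter Set Complex
open Literature.MathematicalPhysics.AQFT Literature.MathematicalPhysics.QuantumLattice
  Literature.MathematicalPhysics.QuantumFieldTheory
open Summit.QuantumFields.YangMills.Cruxes.OSLegsAtWeakCouplingC.Sketch (Separated
  exists_separated_tendsto_of_isOffDiagonal)
open Summit.QuantumFields.QCD.Cruxes.StableActionBridge.Sketch (qcdLatticeDist qcdLatticeDist_zero_apply
  qcdLatticeSchwinger_eq_qcdLatticeDist)

namespace Summit.QuantumFields.QCD.Cruxes.ThinQCD.Registered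

/-- **A countable total family of off-diagonal real tensors WITH FACTOR DATA.**  There is a countable set `𝒢` of
off-diagonal test functions, each the tensor product `⊗ᵢ ofRealTest (fᵢ)` of real, compactly supported one-point test
functions, such that every `F ∈ ⁰𝒮((ℝ⁴)ⁿ)` lies in the closure of the span of `𝒢`.  Same generators as
`exists_countable_total` (real/imaginary split tensors of the box characters of the nested boxes of all integer mesh
vectors at all meshes `1/(24(j+1))`); the factors are supported in the compact blocks of their box. [folklore] -/
theorem exists_countable_total_real :
    ∀ n : ℕ, ∃ 𝒢 : Set (SchwartzMap (Fin n → EuclideanSpace ℝ (Fin 4)) ℂ), 𝒢.Countable ∧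
      (∀ G ∈ 𝒢, IsOffDiagonal G ∧ ∃ f : Fin n → SchwartzMap (EuclideanSpace ℝ (Fin 4)) ℝ,
        IsTensorOf G (fun i => ofRealTest (f i)) ∧
          ∀ i, HasCompactSupport (f i : EuclideanSpace ℝ (Fin 4) → ℝ)) ∧
      ∀ F : SchwartzMap (Fin n → EuclideanSpace ℝ (Fin 4)) ℂ, IsOffDiagonal F →
        F ∈ closure ((Submodule.span ℂ 𝒢 : Submodule ℂ (SchwartzMap (Fin n → EuclideanSpace ℝ (Fin 4)) ℂ)) :
          Set (SchwartzMap (Fin n → EuclideanSpace ℝ (Fin 4)) ℂ)) := by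
  -- adapted from `exists_countable_total` (p166156): same generators, factor data kept
  intro n
  classical
  let box : ℕ → (Fin (n * 4) → ℤ) → BoxData n 4 := fun j β =>
    { l := fun ic => ((β (finProdFinEquiv ic) : ℤ) : ℝ) * (1 / ((j : ℝ) + 1) / 24) - 2 * (1 / ((j : ℝ) + 1) / 24)
      u := fun ic => ((β (finProdFinEquiv ic) : ℤ) : ℝ) * (1 / ((j : ℝ) + 1) / 24) + 2 * (1 / ((j : ℝ) + 1) / 24)
      l' := fun ic => ((β (finProdFinEquiv ic) : ℤ) : ℝ) * (1 / ((j : ℝ) + 1) / 24) - (1 / ((j : ℝ) + 1) / 24)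
      u' := fun ic => ((β (finProdFinEquiv ic) : ℤ) : ℝ) * (1 / ((j : ℝ) + 1) / 24) + (1 / ((j : ℝ) + 1) / 24)
      hl := fun ic => by
        have : (0 : ℝ) < 1 / ((j : ℝ) + 1) / 24 := by positivity
        linarith
      hl' := fun ic => by
        have : (0 : ℝ) < 1 / ((j : ℝ) + 1) / 24 := by positivity
        linarith
      hu := fun ic => by
        have : (0 : ℝ) < 1 / ((j : ℝ) + 1) / 24 := by positivity
        linarith }
  -- the factor tuples and the generators
  let fac : ℕ × (Fin (n * 4) → ℤ) × (Fin n × Fin 4 → ℤ) × Finset (Fin n) →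
      Fin n → SchwartzMap (EuclideanSpace ℝ (Fin 4)) ℝ := fun i l =>
    if l ∈ i.2.2.2
      then reTest ((box i.1 i.2.1).charFactorS (ContinuousLinearEquiv.refl ℝ (EuclideanSpace ℝ (Fin 4))) i.2.2.1 l)
      else imTest ((box i.1 i.2.1).charFactorS (ContinuousLinearEquiv.refl ℝ (EuclideanSpace ℝ (Fin 4))) i.2.2.1 l)
  let gen : ℕ × (Fin (n * 4) → ℤ) × (Fin n × Fin 4 → ℤ) × Finset (Fin n) →
      𝓢((Fin n → (EuclideanSpace ℝ (Fin 4))), ℂ) := fun i =>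
    SchwartzMap.tensorFin n (fun l => ofRealTest (fac i l))
  -- compact support of the factors: they live in the compact blocks of their box
  have hfac : ∀ i l, HasCompactSupport (fac i l : EuclideanSpace ℝ (Fin 4) → ℝ) := by
    rintro ⟨j, β, nn, t⟩ l
    have hq : tsupport ((box j β).charFactorS (ContinuousLinearEquiv.refl ℝ (EuclideanSpace ℝ (Fin 4))) nn l :
        EuclideanSpace ℝ (Fin 4) → ℂ) ⊆ (box j β).blockK (ContinuousLinearEquiv.refl ℝ (EuclideanSpace ℝ (Fin 4))) l :=
      (box j β).tsupport_charFactor_subset _ nn l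
    have hK := (box j β).isCompact_blockK (ContinuousLinearEquiv.refl ℝ (EuclideanSpace ℝ (Fin 4))) l
    dsimp only [fac]
    split_ifs
    · exact IsCompact.of_isClosed_subset hK (isClosed_tsupport _) ((tsupport_reTest_subset _).trans hq)
    · exact IsCompact.of_isClosed_subset hK (isClosed_tsupport _) ((tsupport_imTest_subset _).trans hq)
  refine ⟨{G | IsOffDiagonal G ∧ ∃ i, gen i = G}, ?_, ?_, ?_⟩
  · exact (Set.countable_range gen).mono fun G hG => by
      obtain ⟨_, i, hi⟩ := hG
      exact ⟨i, hi⟩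
  · rintro G ⟨hG, i, rfl⟩
    exact ⟨hG, fac i, isTensorOf_tensorFin _, hfac i⟩
  · intro F hF
    obtain ⟨u, -, hsep, hlim⟩ := exists_separated_tendsto_of_isOffDiagonal F hF
    refine isClosed_closure.mem_of_tendsto hlim (Eventually.of_forall fun m => ?_)
    obtain ⟨δ, hδ, hδsupp⟩ := hsep m
    obtain ⟨j, hj⟩ := exists_nat_one_div_lt hδ
    have hδj : (0 : ℝ) < 1 / ((j : ℝ) + 1) := by positivity
    refine mem_closure_span_of_separated hδj ?_ (hδsupp.trans (separated_anti hj.le))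
    intro β B hBl hBu hBl' hBu' nn t hoff
    have hB : B = box j β := by
      cases B with
      | mk l u l' u' hl hl' hu =>
        have el : l = fun ic => ((β (finProdFinEquiv ic) : ℤ) : ℝ) * (1 / ((j : ℝ) + 1) / 24) -
            2 * (1 / ((j : ℝ) + 1) / 24) := funext hBl
        have eu : u = fun ic => ((β (finProdFinEquiv ic) : ℤ) : ℝ) * (1 / ((j : ℝ) + 1) / 24) +
            2 * (1 / ((j : ℝ) + 1) / 24) := funext hBu
        have el' : l' = fun ic => ((β (finProdFinEquiv ic) : ℤ) : ℝ) * (1 / ((j : ℝ) + 1) / 24) -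
            (1 / ((j : ℝ) + 1) / 24) := funext hBl'
        have eu' : u' = fun ic => ((β (finProdFinEquiv ic) : ℤ) : ℝ) * (1 / ((j : ℝ) + 1) / 24) +
            (1 / ((j : ℝ) + 1) / 24) := funext hBu'
        subst el eu el' eu'
        rfl
    subst hB
    exact ⟨hoff, ⟨j, β, nn, t⟩, rfl⟩

/-- The supports of finitely many compactly supported functions lie in one closed ball. [folklore] -/
theorem exists_tsupport_subset_closedBall {n : ℕ} (f : Fin n → SchwartzMap (EuclideanSpace ℝ (Fin 4)) ℝ)
    (hf : ∀ i, HasCompactSupport (f i : EuclideanSpace ℝ (Fin 4) → ℝ)) :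
    ∃ R : ℝ, ∀ i, tsupport (f i : EuclideanSpace ℝ (Fin 4) → ℝ) ⊆ Metric.closedBall 0 R := by
  have h : ∀ i, ∃ R : ℝ, tsupport (f i : EuclideanSpace ℝ (Fin 4) → ℝ) ⊆ Metric.closedBall 0 R := fun i =>
    (hf i).isCompact.isBounded.subset_closedBall 0
  choose R hR using h
  rcases n with _ | n
  · exact ⟨0, fun i => i.elim0⟩
  · exact ⟨Finset.univ.sup' Finset.univ_nonempty R, fun i =>
      (hR i).trans (Metric.closedBall_subset_closedBall (Finset.le_sup' R (Finset.mem_univ i)))⟩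

end Summit.QuantumFields.QCD.Cruxes.ThinQCD.Registered

/-! ### The stub -/

namespace Summit.QuantumFields.QCD.Theorems.ThinQCD

open Summit.QuantumFields.QCD.Cruxes.ThinQCD.Registered (exists_countable_total_real exists_tsupport_subset_closedBall
  exists_strictMono_forall_pos_tendsto tendsto_offDiagonal_of_generators)

/-- **(DE″) Diagonal extraction from per-tuple tightness and the TENSOR-currency mass-Lipschitz modulus** — registered
stub `stub_diagonalExtractionT` of skeleton r6 of line `registered` (crux `ThinQCD`, stmt-QuantumFields-17278), signature
verbatim.  Labels `(n, σ, G)`, `G` ranging over the countable total family of `exists_countable_total_real`; the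
Arzelà–Ascoli lemma gives `ψ` and convergence on the generators (bounds from the tightness at `m`, modulus from the
tensor Lipschitz hypothesis through `qcdLatticeSchwinger_eq_qcdLatticeDist`, degree `0` constant); the ε/3 lemma and
totality give convergence on all of `⁰𝒮`. [folklore] -/
theorem stub_diagonalExtractionT :
    ∀ (Nf : ℕ) (reg : QCDRegularisation Nf) (𝒞 : CalibratedSpeciesFamily reg),
    (∀ m : Fin Nf → ℝ, (∀ f, 0 < m f) →
      ∃ (s : ℕ) (α β : ℝ), ∀ (n : ℕ) (σ : Fin n → QCDField Nf), ∀ᶠ k in Filter.atTop,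
        ∀ F : SchwartzMap (Fin n → EuclideanSpace ℝ (Fin 4)) ℂ, IsOffDiagonal F →
          ‖qcdLatticeDist (𝒞.scheme m) k n σ F‖ ≤ α * (n.factorial : ℝ) ^ β * schwartzNorm (n * s) F) →
    (∀ n : ℕ, n ≠ 0 → ∀ (σ : Fin n → QCDField Nf) (f : Fin n → SchwartzMap (EuclideanSpace ℝ (Fin 4)) ℝ)
      (F : SchwartzMap (Fin n → EuclideanSpace ℝ (Fin 4)) ℂ), IsTensorOf F (fun i => ofRealTest (f i)) →
        IsOffDiagonal F → ∀ R : ℝ, (∀ i, tsupport (f i) ⊆ Metric.closedBall 0 R) →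
          ∀ K : Set (Fin Nf → ℝ), IsCompact K → K ⊆ {m | ∀ fl, 0 < m fl} →
            ∃ C : ℝ, ∀ᶠ k in Filter.atTop, ∀ m ∈ K, ∀ m' ∈ K,
              ‖qcdLatticeSchwinger (𝒞.scheme m) k n σ f - qcdLatticeSchwinger (𝒞.scheme m') k n σ f‖ ≤
                C * ‖m - m'‖) →
    ∃ ψ : ℕ → ℕ, StrictMono ψ ∧ ∀ m : Fin Nf → ℝ, (∀ f, 0 < m f) →
      ∀ (n : ℕ) (σ : Fin n → QCDField Nf) (F : SchwartzMap (Fin n → EuclideanSpace ℝ (Fin 4)) ℂ), IsOffDiagonal F →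
        ∃ c : ℂ, Filter.Tendsto (fun k : ℕ => qcdLatticeDist (𝒞.scheme m) (ψ k) n σ F) Filter.atTop (nhds c) := by
  -- adapted from `stub_diagonalExtraction` (p167000)
  intro Nf reg 𝒞 hT hL
  -- a countable total family of off-diagonal real tensors with factor data, in each degree
  choose 𝒢 h𝒢c h𝒢off h𝒢tot using fun n : ℕ => exists_countable_total_real n
  haveI : ∀ n : ℕ, Countable (𝒢 n) := fun n => (h𝒢c n).to_subtype
  -- the countable labels `(n, σ, G)` and the Arzelà–Ascoli extraction
  obtain ⟨ψ, hψ, hlim⟩ := exists_strictMono_forall_pos_tendsto (ι := Σ n : ℕ, (Fin n → QCDField Nf) × 𝒢 n)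
    (fun k i m => qcdLatticeDist (𝒞.scheme m) k i.1 i.2.1 (i.2.2 : SchwartzMap (Fin i.1 → EuclideanSpace ℝ (Fin 4)) ℂ))
    (fun i m hm => by
      -- eventual bounds at every positive tuple (tightness at `m`)
      obtain ⟨n, σ, G⟩ := i
      obtain ⟨s, α, β, hbound⟩ := hT m hm
      exact ⟨α * (n.factorial : ℝ) ^ β * schwartzNorm (n * s) (G : SchwartzMap (Fin n → EuclideanSpace ℝ (Fin 4)) ℂ),
        (hbound n σ).mono fun k hk => hk _ (h𝒢off n G G.2).1⟩)
    (fun i K hK hKP => by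
      -- the eventually-uniform Lipschitz modulus on compacts: degree `0` is constant, degree `≥ 1` is a real tensor
      obtain ⟨n, σ, G⟩ := i
      rcases Nat.eq_zero_or_pos n with rfl | hn
      · refine ⟨0, Eventually.of_forall fun k m _ m' _ => ?_⟩
        simp [qcdLatticeDist_zero_apply]
      · obtain ⟨hGoff, f, hGf, hfc⟩ := h𝒢off n G G.2
        obtain ⟨R, hR⟩ := exists_tsupport_subset_closedBall f hfc
        obtain ⟨C, hC⟩ := hL n hn.ne' σ f (G : SchwartzMap (Fin n → EuclideanSpace ℝ (Fin 4)) ℂ) hGf hGoff R hR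
          K hK hKP
        refine ⟨C, hC.mono fun k hk m hm m' hm' => ?_⟩
        have e1 := qcdLatticeSchwinger_eq_qcdLatticeDist (𝒞.scheme m) k n hn.ne' σ f _ hGf
        have e2 := qcdLatticeSchwinger_eq_qcdLatticeDist (𝒞.scheme m') k n hn.ne' σ f _ hGf
        simpa only [e1, e2] using hk m hm m' hm')
  -- assembly at a positive tuple `m`: ε/3 over the total countable family `𝒢 n`
  refine ⟨ψ, hψ, fun m hm n σ => ?_⟩
  obtain ⟨s, α, β, hbound⟩ := hT m hm
  refine tendsto_offDiagonal_of_generators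
    (fun k => qcdLatticeDist (𝒞.scheme m) (ψ k) n σ) (𝒢 n) (C := α * (n.factorial : ℝ) ^ β) (M := n * s)
    ((hψ.tendsto_atTop.eventually (hbound n σ)).mono fun k hk F hF => hk F hF)
    (fun G hG => (h𝒢off n G hG).1) (h𝒢tot n) fun G hG => ?_
  obtain ⟨l, hl⟩ := hlim m hm ⟨n, σ, ⟨G, hG⟩⟩
  exact ⟨l, hl⟩

end Summit.QuantumFields.QCD.Theorems.ThinQCD

end
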